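import Literature.MathematicalPhysics.QuantumFieldTheory.Balaban1983to89.B4GaussRep36Proof

/-!
# `Balaban1983to89.B4Sect3BlockAveraging` — T. Bałaban, *Regularity and decay of lattice Green's functions*, Commun.
# Math. Phys. **89** (1983) 571–597 [Balaban1983RegularityDecay], Sect. 3 pp. 586–588: the structural hypotheses of
# the Gaussian representation (3.6)/(3.8) DISCHARGED for the block-averaging operators (1.4)/(3.2), the two functions
# (3.7) (supports and norms), and (3.6) with the positivity of (3.5) as the only operator hypothesis

statement-level skeleton of published theorems with citation tags; proofs where landed; nothing here is a claim about the Yang–Mills mass gap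

PDF held: `paper:balaban1983-cmp89-regularity-decay` (journal page = PDF page + 570); renders
`run/shared/lean/pub/pub-balaban/b2b-balaban-ref1/pages/1983-cmp89-regularity-decay/1983-cmp89-regularity-decay-p017-x2.png`,
`…-p018-x2.png` read as images.

CITATION HEADER (lean-in-tree rule).  lit-balaban cell (HOME `run/shared/lean/pub/lit-balaban/`), unit `lit-balaban-r01`
(reader/typer of CMP 89 = block B4; gen 3), SKELETON rows `B4.Eq3.6` (proved p240595 `B4GaussRep36Proof.rep36`),
`B4.Eq3.7` (typed p238964: `B4GaussRep36.qk`, `qk1`, `tOp`, `tOp_row`), `B4.Eq1.4` ((1.4) `B4GaugeCovariance.avgOp`).  This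
module is a KNITTING file of the paper fold owner: it connects the plain-matrix statement file `B4GaussRep36` (whose
(3.6) `Rep36` carries the abstract structure hypotheses `RowOrtho w Q` («`QQᵀ = w⁻¹·1`») and `BlockCompatible Q Λ Λ'`
(«no `L`-block straddles `∂Λ`»)) with the concrete averaging operators (1.4) of `B4GaugeCovariance` (`avgOp q T =
blockOp (q(y,x)·T(y,x))`, block weights `q`, parallel transporters `T(y,x) = U(A(Γ_{y,x}))`).  No definition is
introduced; no existing module is touched; nothing of the paper beyond the sentences quoted below is asserted.

THE PRINT (verbatim).  p. 572 (1.4): *"(Q_k(A)φ)(y) = Σ_{x∈B^k(y)} η^d U(A(Γ^{(k)}_{y,x}))φ(x)"*; p. 587 (3.2): *"(Q(A)ψ)(z) =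
Σ_{y∈B(z)} L^{−d}U(A(Γ_{z,y}))ψ(y)"* and *"Q(A)Q_k(A)φ = Q_{k+1}(A)φ"*; p. 574: *"for arbitrary Λ ⊂ Ω^{(k)} = Ω∩Z^d, Λ
being a sum of big blocks"*; p. 588 (3.7): *"q_k(y,x) = a column of U(A(Γ^{(k)}_{x,y})) for x∈B^k(y), 0 otherwise,
q_{k+1}(y,x) = a column of L^{−d}U(A(Γ^{(k+1)}_{x,z}∪Γ_{z,y})) for x∈B^{k+1}(z), z such that y∈B(z), 0 otherwise, (3.7)"*
and *"The L²-norms of the functions q_k(y), q_{k+1}(y) are equal to 1, L^{−d/2} and their supports are in B^k(y),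
B^{k+1}(z(y)) respectively"*; p. 573 (1.8): *"we will consider the expression ⟨φ,(−Δ^η_A + m_k² + a_kP_k(A))φ⟩ … and
we have γ₀ > 0"* (positivity of the forms).

WHAT IS PROVED (kernel, zero `sorry`; the block geometry is ABSTRACT: a block map `blk : sites → block labels` whose
fibres are the blocks, so that tori, boxes and the unions of big blocks of p. 572 are all instances):
* `avgOp_mul_transpose`: for weights `q(y,x) = c·1[x ∈ B(y)]`, blocks of `n` sites and orthogonal transporters,
  `QQᵀ = c²n·1` — for the `L`-averaging (3.2) (`c = L^{−d} = n⁻¹`) this is `RowOrtho L^d Q` (`rowOrtho_avgOp`), for (1.4)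
  (`c = η^d`, `n = η^{−d}`) it is `Q_kQ_kᵀ = η^d·1`, the plain form of *"The L²-norms of the functions q_k(y) … are
  equal to 1"* (DICTIONARY of `B4GaussRep36`: `η^{−d}·(row·row) = ‖q_k(y)‖²₂`);
* `blockCompatible_avgOp`: `BlockCompatible Q Λ Λ'` whenever `Λ = ⋃_{z∈Λ'}B(z)` («Λ being a sum of big blocks»);
* `avgOp_row_support`/`avgOp_row_support_compl`, `tOp_apply_ne_zero`: the rows of `Q_k` are supported in the blocks
  `B^k(y)`, and the functions `−(a_{k+1}/a_k)L^{−2}q_{k+1}(y) + q_k(y)` of (3.8) (`tOp`) in the `L`-blocks `B^{k+1}(z(y))`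
  — the support halves of the p. 588 sentence, in the form consumed by `B4Ineq310Proof.ineq310` (`hR`) and by (1.16)/(1.18);
* `tOp_mul_transpose`, `tOp_row_sq_le`, `tOp_gram_form_le`: the Gram matrix of those functions is
  `c_k·(1 − θ(2−θ)P_{Λ'})|_Λ`, `θ = a_{k+1}L^{−2}/a_k ∈ [0,1)`, `P_{Λ'} = wQᵀ1_{Λ'}Q` a projection — hence each has plain
  square norm `≤ c_k` (the norm half of the sentence, as the upper bound that (1.15)/(1.16)/(1.18) consume);
* `posSemidef_kForm_sub_kLam`, `kForm_posDef_of_kLam_posDef`, `isSymm_of_kLam_posDef`: the form `K̂ = H + a_kQ_kᵀQ_k` of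
  (1.6) dominates the two-scale form `K̂_Λ` of (3.5) in the Löwner order (`K̂ − K̂_Λ = Q_kᵀ1_Λ(a_k − a_{k+1}L^{−2}P)1_ΛQ_k ⪰ 0`,
  `a_k − a_{k+1}L^{−2} = a_k²/(aL^{−2} + a_k) > 0`), so the positivity (1.8) of (3.5) alone gives that of (1.6) and the
  symmetry of `H` — the "Schur-complement remark" of the `Rep36` docstring, made a theorem;
* `rep36_of_kLam_posDef`, `rep36_avgOp`: (3.6) `cLam = rep36Rhs` with ONLY `a_k, a, L^{−2}, L^d > 0`, the block geometry
  and the positivity of the form (3.5) as hypotheses (from `B4GaussRep36Proof.rep36`, used BY NAME).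
-/

namespace Literature.MathematicalPhysics.QuantumFieldTheory.Balaban1983to89.B4Sect3BlockAveraging

open Matrix Finset B4GaussRep36 B4GaugeCovariance

variable {X Y Z ι : Type*}

/-! ## §0. Plain-matrix helpers -/

/-- `D_S` is symmetric. [folklore] -/
private theorem diagInd_transpose [DecidableEq Y] (S : Finset Y) : (diagInd S)ᵀ = diagInd S :=
  Matrix.diagonal_transpose _

/-- `D_S D_S = D_S`. [folklore] -/
private theorem diagInd_mul_self [Fintype Y] [DecidableEq Y] (S : Finset Y) :
    diagInd S * diagInd S = diagInd S := by
  rw [diagInd, Matrix.diagonal_mul_diagonal]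
  congr 1
  funext y
  by_cases hy : y ∈ S <;> simp [hy]

/-- `D_{Sᶜ} = 1 − D_S`. [folklore] -/
private theorem diagInd_compl [Fintype Y] [DecidableEq Y] (S : Finset Y) :
    diagInd Sᶜ = (1 : Matrix Y Y ℝ) - diagInd S := by
  ext i j
  by_cases hij : i = j
  · subst hij; by_cases hi : i ∈ S <;> simp [diagInd, hi]
  · simp [diagInd, hij]

/-- `(A|_{rows e})(B|^{cols f}) = (AB)|_{e,f}`. [folklore] -/
private theorem submatrix_id_mul [Fintype X] {κ κ' : Type*} (A : Matrix Y X ℝ) (B : Matrix X Y ℝ) (e : κ → Y)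
    (f : κ' → Y) : A.submatrix e id * B.submatrix id f = (A * B).submatrix e f := by
  ext i j
  simp [Matrix.mul_apply]

/-- entrywise `submatrix` of a scalar multiple. [folklore] -/
private theorem sm_smul {m n l o : Type*} (r : ℝ) (A : Matrix m n ℝ) (e : l → m) (f : o → n) :
    (r • A).submatrix e f = r • A.submatrix e f := rfl

/-- entrywise `submatrix` of a difference. [folklore] -/
private theorem sm_sub {m n l o : Type*} (A B : Matrix m n ℝ) (e : l → m) (f : o → n) :
    (A - B).submatrix e f = A.submatrix e f - B.submatrix e f := rfl

/-! ## §1. The block-averaging matrices (1.4)/(3.2): entries, supports, `RowOrtho`, `BlockCompatible` -/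

/-- Entries of the averaging matrix (1.4): `Q((y,i),(x,j)) = q(y,x)·T(y,x)_{ij}`. [cite: Balaban1983RegularityDecay, (1.4) p.572] -/
theorem avgOp_apply (q : Y → X → ℝ) (T : Y → X → Matrix ι ι ℝ) (p : Y × ι) (r : X × ι) :
    avgOp q T p r = q p.1 r.1 * T p.1 r.1 p.2 r.2 := by
  simp only [avgOp, blockOp_apply, Matrix.smul_apply, smul_eq_mul]

/-- SUPPORT OF THE ROWS of a block-averaging matrix: with block weights (`q(y,x) = 0` unless `x ∈ B(y)`, the block
`B(y)` being the fibre `blk⁻¹(y)`), the row `(y,i)` of `Q` is supported in `B(y)` — *"q_k(y,x) = … for x∈B^k(y), 0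
otherwise"* (3.7). [cite: Balaban1983RegularityDecay, (3.7) p.588] -/
theorem avgOp_apply_ne_zero {blk : X → Y} {q : Y → X → ℝ} (hq : ∀ y x, blk x ≠ y → q y x = 0)
    (T : Y → X → Matrix ι ι ℝ) {p : Y × ι} {r : X × ι} (h : avgOp q T p r ≠ 0) : blk r.1 = p.1 := by
  by_contra hne
  exact h (by rw [avgOp_apply, hq _ _ hne, zero_mul])

/-- «Λ being a sum of big blocks» (p. 574) ⇒ `BlockCompatible`: if `Λ = {(y,i) | Blk y ∈ S'}` is the union of the
blocks labelled by `S'` and `Λ' = S' × colours`, no block of the averaging `Q` (3.2) straddles `∂Λ`.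
[cite: Balaban1983RegularityDecay, Prop. 2.3 of [1] p.574, (3.1) p.586] -/
theorem blockCompatible_avgOp {Blk : Y → Z} {q : Z → Y → ℝ} (hq : ∀ z y, Blk y ≠ z → q z y = 0)
    (T : Z → Y → Matrix ι ι ℝ) {S' : Finset Z} {Λ : Finset (Y × ι)} {Λ' : Finset (Z × ι)}
    (hΛ : ∀ p, p ∈ Λ ↔ Blk p.1 ∈ S') (hΛ' : ∀ r, r ∈ Λ' ↔ r.1 ∈ S') :
    BlockCompatible (avgOp q T) Λ Λ' := by
  intro r p h
  rw [hΛ p, hΛ' r, avgOp_apply_ne_zero hq T h]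

/-- The rows `y ∈ Λ` of `Q_k` (1.4) are supported in `B^k(Λ) = ⋃_{y∈Λ}B^k(y)` (here `Λ` = the unit blocks whose
`L`-block label lies in `S'`, `B^k(Λ)` = the sites `x` with `Blk(blk x) ∈ S'`). [cite: Balaban1983RegularityDecay, (3.7) p.588] -/
theorem avgOp_row_support [Fintype X] [Fintype ι] [DecidableEq Z] {blk : X → Y} {Blk : Y → Z} {q : Y → X → ℝ}
    (hq : ∀ y x, blk x ≠ y → q y x = 0) (T : Y → X → Matrix ι ι ℝ) {S' : Finset Z} {Λ : Finset (Y × ι)}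
    (hΛ : ∀ p, p ∈ Λ ↔ Blk p.1 ∈ S') :
    ∀ p r, p ∈ Λ → avgOp q T p r ≠ 0 → r ∈ (univ.filter fun r : X × ι => Blk (blk r.1) ∈ S') := by
  intro p r hp h
  rw [Finset.mem_filter, avgOp_apply_ne_zero hq T h]
  exact ⟨mem_univ _, (hΛ p).mp hp⟩

/-- The rows `y ∉ Λ` of `Q_k` (1.4) are supported in `B^k(Λ^c)` — the hypothesis `hR` of `B4Ineq310Proof.ineq310`
((3.10)), DISCHARGED for block-averaging matrices. [cite: Balaban1983RegularityDecay, (3.7) p.588, (3.10) p.589] -/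
theorem avgOp_row_support_compl [Fintype X] [Fintype ι] [DecidableEq Z] {blk : X → Y} {Blk : Y → Z}
    {q : Y → X → ℝ} (hq : ∀ y x, blk x ≠ y → q y x = 0) (T : Y → X → Matrix ι ι ℝ) {S' : Finset Z}
    {Λ : Finset (Y × ι)} (hΛ : ∀ p, p ∈ Λ ↔ Blk p.1 ∈ S') :
    ∀ p r, p ∉ Λ → avgOp q T p r ≠ 0 → r ∈ (univ.filter fun r : X × ι => Blk (blk r.1) ∉ S') := by
  intro p r hp h
  rw [Finset.mem_filter, avgOp_apply_ne_zero hq T h]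
  exact ⟨mem_univ _, fun hS => hp ((hΛ p).mpr hS)⟩

/-- ORTHOGONALITY OF THE ROWS of a block-averaging matrix: for block weights `q(y,x) = c·1[x ∈ B(y)]`, every block
having `n` sites, and orthogonal transporters `T(y,x)` (`U(A(Γ_{y,x})) ∈ O(N)`), `QQᵀ = c²n·1`.  For (1.4) (`c = η^d`,
`n = η^{−d}` sites in a unit block) this reads `Q_kQ_kᵀ = η^d·1`: the rows `q_k(y)` are pairwise orthogonal and — in
[B4]'s `η`-weighted norm, DICTIONARY of `B4GaussRep36` — *"The L²-norms of the functions q_k(y) … are equal to 1"*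
(p. 588). [cite: Balaban1983RegularityDecay, (1.4) p.572, (3.7) p.588] -/
theorem avgOp_mul_transpose [Fintype X] [Fintype ι] [DecidableEq Y] [DecidableEq ι] (blk : X → Y)
    (q : Y → X → ℝ) (T : Y → X → Matrix ι ι ℝ) (c : ℝ) (n : ℕ)
    (hq : ∀ y x, blk x ≠ y → q y x = 0) (hqc : ∀ x, q (blk x) x = c)
    (hcard : ∀ y, (univ.filter fun x => blk x = y).card = n)
    (hT : ∀ x, T (blk x) x * (T (blk x) x)ᵀ = 1) :
    avgOp q T * (avgOp q T)ᵀ = (c ^ 2 * n) • (1 : Matrix (Y × ι) (Y × ι) ℝ) := by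
  ext ⟨y, i⟩ ⟨y', j⟩
  simp only [Matrix.mul_apply, Matrix.transpose_apply, avgOp_apply, Matrix.smul_apply,
    Matrix.one_apply, smul_eq_mul, Fintype.sum_prod_type, Prod.mk.injEq]
  by_cases hy : y = y'
  · subst hy
    have hx : ∀ x, ∑ k, q y x * T y x i k * (q y x * T y x j k) =
        if blk x = y then c ^ 2 * (if i = j then 1 else 0) else 0 := by
      intro x
      by_cases hbx : blk x = y
      · subst hbx
        have h1 : (T (blk x) x * (T (blk x) x)ᵀ) i j = (1 : Matrix ι ι ℝ) i j := by rw [hT x]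
        rw [Matrix.mul_apply, Matrix.one_apply] at h1
        simp only [Matrix.transpose_apply] at h1
        rw [if_pos rfl, hqc x, ← h1, Finset.mul_sum]
        exact Finset.sum_congr rfl fun k _ => by ring
      · rw [if_neg hbx, hq _ _ hbx]
        simp
    rw [Finset.sum_congr rfl fun x _ => hx x, ← Finset.sum_filter, Finset.sum_const, hcard]
    by_cases hij : i = j
    · subst hij
      simp only [and_self, ite_true, nsmul_eq_mul, mul_one]
      ring
    · simp [hij]
  · have hx : ∀ x, ∑ k, q y x * T y x i k * (q y' x * T y' x j k) = 0 := by
      intro x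
      by_cases hbx : blk x = y
      · have hne : blk x ≠ y' := fun h => hy (hbx.symm.trans h)
        simp [hq _ _ hne]
      · simp [hq _ _ hbx]
    rw [Finset.sum_congr rfl fun x _ => hx x, Finset.sum_const_zero]
    simp [hy]

/-- `RowOrtho L^d Q` for the `L`-block averaging (3.2) *"(Q(A)ψ)(z) = Σ_{y∈B(z)} L^{−d}U(A(Γ_{z,y}))ψ(y)"*: weights
`n⁻¹` on blocks of `n` (`= L^d`) sites, orthogonal transporters ⇒ `QQᵀ = n⁻¹·1` — the structure hypothesis of
`B4GaussRep36.Rep36` DISCHARGED (also the plain form of *"The L²-norms of the functions … q_{k+1}(y) are equal to …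
L^{−d/2}"*, p. 588). [cite: Balaban1983RegularityDecay, (3.2) p.587, (3.6) p.588] -/
theorem rowOrtho_avgOp [Fintype X] [Fintype ι] [DecidableEq Y] [DecidableEq ι] (blk : X → Y) (q : Y → X → ℝ)
    (T : Y → X → Matrix ι ι ℝ) (n : ℕ) (hq : ∀ y x, blk x ≠ y → q y x = 0) (hqc : ∀ x, q (blk x) x = (n : ℝ)⁻¹)
    (hcard : ∀ y, (univ.filter fun x => blk x = y).card = n)
    (hT : ∀ x, T (blk x) x * (T (blk x) x)ᵀ = 1) : RowOrtho (n : ℝ) (avgOp q T) := by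
  unfold RowOrtho
  rw [avgOp_mul_transpose blk q T _ n hq hqc hcard hT]
  congr 1
  by_cases hn : (n : ℝ) = 0
  · simp [hn]
  · rw [pow_two, mul_assoc, inv_mul_cancel₀ hn, mul_one]

/-! ## §2. The form `K̂ = H + a_kQ_kᵀQ_k` (1.6) dominates the two-scale form `K̂_Λ` (3.5): positivity (1.8) of (3.5)
alone suffices for (3.6) -/

/-- Under `BlockCompatible` the block indicators intertwine the averaging: `Qᵀ1_{Λ'}Q = 1_Λ(QᵀQ)1_Λ`. [folklore] -/
private theorem transpose_diagInd_mul [Fintype Y] [Fintype Z] [DecidableEq Y] [DecidableEq Z] {Q : Matrix Z Y ℝ}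
    {Λ : Finset Y} {Λ' : Finset Z} (hB : BlockCompatible Q Λ Λ') :
    Qᵀ * diagInd Λ' * Q = diagInd Λ * (Qᵀ * Q) * diagInd Λ := by
  ext y y'
  have lhs : (Qᵀ * diagInd Λ' * Q) y y' = ∑ z, Q z y * (if z ∈ Λ' then 1 else 0) * Q z y' := by
    rw [Matrix.mul_apply]
    refine Finset.sum_congr rfl fun z _ => ?_
    simp only [diagInd, Matrix.mul_diagonal, Matrix.transpose_apply]
  have rhs : (diagInd Λ * (Qᵀ * Q) * diagInd Λ) y y' =
      ∑ z, (if y ∈ Λ then 1 else 0) * (Q z y * Q z y') * (if y' ∈ Λ then 1 else 0) := by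
    simp only [diagInd, Matrix.mul_diagonal, Matrix.diagonal_mul]
    rw [Matrix.mul_apply, Finset.mul_sum, Finset.sum_mul]
    refine Finset.sum_congr rfl fun z _ => ?_
    rw [Matrix.transpose_apply]
  rw [lhs, rhs]
  refine Finset.sum_congr rfl fun z _ => ?_
  by_cases h1 : Q z y = 0
  · simp [h1]
  by_cases h2 : Q z y' = 0
  · simp [h2]
  have e1 := hB z y h1
  have e2 := hB z y' h2
  by_cases hz : z ∈ Λ'
  · simp [hz, e1.mpr hz, e2.mpr hz]
  · have hy : y ∉ Λ := fun h => hz (e1.mp h)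
    simp [hz, hy]

/-- `P = wQᵀQ` is idempotent under `RowOrtho`: `P² = P` (an orthogonal projection). [cite: Balaban1983RegularityDecay, (1.5) p.572, (3.6) p.588] -/
theorem pOp_mul_pOp [Fintype Y] [Fintype Z] [DecidableEq Z] {w : ℝ} {Q : Matrix Z Y ℝ} (hQ : RowOrtho w Q)
    (hw : w ≠ 0) : pOp w Q * pOp w Q = pOp w Q := by
  have hQ' : Q * Qᵀ = w⁻¹ • (1 : Matrix Z Z ℝ) := hQ
  calc pOp w Q * pOp w Q = (w * w) • (Qᵀ * (Q * Qᵀ) * Q) := by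
        simp only [pOp, Matrix.smul_mul, Matrix.mul_smul, smul_smul, Matrix.mul_assoc]
    _ = (w * w * w⁻¹) • (Qᵀ * Q) := by
        rw [hQ']
        simp only [Matrix.smul_mul, Matrix.mul_smul, smul_smul, Matrix.mul_one]
    _ = pOp w Q := by rw [mul_inv_cancel_right₀ hw, pOp]

/-- `P = wQᵀQ` is symmetric. [cite: Balaban1983RegularityDecay, (1.5) p.572] -/
theorem pOp_transpose [Fintype Z] (w : ℝ) (Q : Matrix Z Y ℝ) : (pOp w Q)ᵀ = pOp w Q := by
  rw [pOp, Matrix.transpose_smul, Matrix.transpose_mul, Matrix.transpose_transpose]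

/-- `0 ≤ ⟨v, Pv⟩ = w|Qv|²` (`w ≥ 0`). [cite: Balaban1983RegularityDecay, (1.5) p.572] -/
theorem dotProduct_pOp_mulVec_nonneg [Fintype Y] [Fintype Z] {w : ℝ} (hw : 0 ≤ w) (Q : Matrix Z Y ℝ)
    (v : Y → ℝ) : 0 ≤ v ⬝ᵥ (pOp w Q *ᵥ v) := by
  rw [pOp, Matrix.smul_mulVec, dotProduct_smul, ← Matrix.mulVec_mulVec, Matrix.dotProduct_mulVec,
    Matrix.vecMul_transpose, smul_eq_mul]
  exact mul_nonneg hw (by simpa using dotProduct_star_self_nonneg (Q *ᵥ v))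

/-- `⟨v, Pv⟩ ≤ |v|²` for the projection `P = wQᵀQ` (`RowOrtho`): `|v|² − ⟨v,Pv⟩ = |(1 − P)v|²`.
[cite: Balaban1983RegularityDecay, (1.5) p.572] -/
theorem dotProduct_pOp_mulVec_le [Fintype Y] [Fintype Z] [DecidableEq Y] [DecidableEq Z] {w : ℝ}
    {Q : Matrix Z Y ℝ} (hQ : RowOrtho w Q) (hw : w ≠ 0) (v : Y → ℝ) :
    v ⬝ᵥ (pOp w Q *ᵥ v) ≤ v ⬝ᵥ v := by
  have hP : ((1 : Matrix Y Y ℝ) - pOp w Q)ᵀ * ((1 : Matrix Y Y ℝ) - pOp w Q) = 1 - pOp w Q := by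
    rw [Matrix.transpose_sub, Matrix.transpose_one, pOp_transpose, Matrix.sub_mul, Matrix.mul_sub,
      Matrix.mul_sub, pOp_mul_pOp hQ hw]
    simp only [Matrix.one_mul, Matrix.mul_one]
    abel
  have h0 : 0 ≤ v ⬝ᵥ (((1 : Matrix Y Y ℝ) - pOp w Q) *ᵥ v) := by
    rw [← hP, ← Matrix.mulVec_mulVec, Matrix.dotProduct_mulVec, Matrix.vecMul_transpose]
    simpa using dotProduct_star_self_nonneg (((1 : Matrix Y Y ℝ) - pOp w Q) *ᵥ v)
  rw [Matrix.sub_mulVec, Matrix.one_mulVec, dotProduct_sub] at h0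
  linarith

/-- The difference of the two forms: `K̂ − K̂_Λ = Q_kᵀ1_Λ(a_k·1 − a_{k+1}L^{−2}·P)1_ΛQ_k` (`K̂ = H + a_kQ_kᵀQ_k` (1.6),
`K̂_Λ` the form of (3.5), `P = wQᵀQ`), under `BlockCompatible`. [cite: Balaban1983RegularityDecay, (1.6) p.572, (3.5) p.587] -/
theorem kForm_sub_kLam [Fintype X] [Fintype Y] [Fintype Z] [DecidableEq Y] [DecidableEq Z] (H : Matrix X X ℝ)
    (ak : ℝ) (Qk : Matrix Y X ℝ) (a ℓ w : ℝ) {Q : Matrix Z Y ℝ} {Λ : Finset Y} {Λ' : Finset Z}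
    (hB : BlockCompatible Q Λ Λ') :
    kForm H ak Qk - kLam H ak Qk a ℓ w Q Λ Λ' =
      Qkᵀ * diagInd Λ * (ak • (1 : Matrix Y Y ℝ) - (aNext a ak ℓ * ℓ) • pOp w Q) * diagInd Λ * Qk := by
  have h1 : (aNext a ak ℓ * w * ℓ) • ((qNext Q Qk)ᵀ * diagInd Λ' * qNext Q Qk) =
      (aNext a ak ℓ * ℓ) • (Qkᵀ * diagInd Λ * pOp w Q * diagInd Λ * Qk) := by
    rw [qNext, Matrix.transpose_mul, pOp]
    have : Qkᵀ * Qᵀ * diagInd Λ' * (Q * Qk) = Qkᵀ * (Qᵀ * diagInd Λ' * Q) * Qk := by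
      simp only [Matrix.mul_assoc]
    rw [this, transpose_diagInd_mul hB]
    simp only [Matrix.mul_assoc, Matrix.mul_smul, Matrix.smul_mul, smul_smul]
    congr 1
    ring
  rw [kLam, h1, kForm, diagInd_compl]
  simp only [Matrix.mul_sub, Matrix.sub_mul, Matrix.mul_smul, Matrix.smul_mul, Matrix.mul_one,
    Matrix.mul_assoc, smul_sub]
  rw [← Matrix.mul_assoc (diagInd Λ) (diagInd Λ) Qk, diagInd_mul_self]
  abel

/-- `a_k − a_{k+1}L^{−2} = a_k²/(aL^{−2} + a_k)` (from *"a_{k+1} = aa_k/(aL^{−2} + a_k)"*, p. 587). [cite: Balaban1983RegularityDecay, (3.4) p.587] -/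
theorem ak_sub_aNext_mul (a ak ℓ : ℝ) (h : a * ℓ + ak ≠ 0) :
    ak - aNext a ak ℓ * ℓ = ak ^ 2 / (a * ℓ + ak) := by
  rw [aNext, eq_div_iff h]
  field_simp
  ring

/-- LÖWNER DOMINATION: `K̂ − K̂_Λ ⪰ 0` — the form of `G_k(Ω,A)` (1.6) dominates the two-scale form of `G_k(Ω,Λ,A)` (3.5)
(`a_k, a, L^{−2}, L^d > 0`, `RowOrtho`, `BlockCompatible`). [cite: Balaban1983RegularityDecay, (1.6) p.572, (3.5) p.587] -/
theorem posSemidef_kForm_sub_kLam [Fintype X] [Fintype Y] [Fintype Z] [DecidableEq X] [DecidableEq Y]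
    [DecidableEq Z] (H : Matrix X X ℝ) {ak : ℝ} (Qk : Matrix Y X ℝ) {a ℓ w : ℝ} {Q : Matrix Z Y ℝ}
    {Λ : Finset Y} {Λ' : Finset Z} (hak : 0 < ak) (ha : 0 < a) (hℓ : 0 < ℓ) (hw : 0 < w) (hQ : RowOrtho w Q)
    (hB : BlockCompatible Q Λ Λ') : (kForm H ak Qk - kLam H ak Qk a ℓ w Q Λ Λ').PosSemidef := by
  set M : Matrix Y Y ℝ := ak • (1 : Matrix Y Y ℝ) - (aNext a ak ℓ * ℓ) • pOp w Q with hMdef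
  have hden : a * ℓ + ak ≠ 0 := (add_pos (mul_pos ha hℓ) hak).ne'
  have hcoef : 0 ≤ aNext a ak ℓ * ℓ := by
    rw [aNext]; positivity
  have hM : M.PosSemidef := by
    refine Matrix.PosSemidef.of_dotProduct_mulVec_nonneg ?_ fun v => ?_
    · rw [Matrix.IsHermitian, Matrix.conjTranspose_eq_transpose_of_trivial, hMdef, Matrix.transpose_sub,
        Matrix.transpose_smul, Matrix.transpose_smul, Matrix.transpose_one, pOp_transpose]
    · have hle := dotProduct_pOp_mulVec_le hQ hw.ne' v
      have hgap : 0 ≤ ak - aNext a ak ℓ * ℓ := by rw [ak_sub_aNext_mul a ak ℓ hden]; positivity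
      have hvv : 0 ≤ v ⬝ᵥ v := by simpa using dotProduct_star_self_nonneg v
      rw [star_trivial, hMdef, Matrix.sub_mulVec, dotProduct_sub, Matrix.smul_mulVec, Matrix.smul_mulVec,
        Matrix.one_mulVec, dotProduct_smul, dotProduct_smul, smul_eq_mul, smul_eq_mul]
      nlinarith [mul_nonneg hgap hvv, mul_le_mul_of_nonneg_left hle hcoef]
  have hconj : (diagInd Λ * Qk)ᴴ * M * (diagInd Λ * Qk) = Qkᵀ * diagInd Λ * M * diagInd Λ * Qk := by
    rw [Matrix.conjTranspose_eq_transpose_of_trivial, Matrix.transpose_mul, diagInd_transpose]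
    simp only [Matrix.mul_assoc]
  rw [kForm_sub_kLam H ak Qk a ℓ w hB, ← hMdef, ← hconj]
  exact hM.conjTranspose_mul_mul_same _

/-- POSITIVITY (1.8) OF (3.5) IMPLIES THAT OF (1.6): if the form `K̂_Λ` of `G_k(Ω,Λ,A)` is positive definite, so is
`K̂ = H + a_kQ_kᵀQ_k` (hence `G_k(Ω,A)` exists) — the hypothesis `(kForm H ak Qk).PosDef` of `B4GaussRep36.Rep36` is
redundant given the others. [cite: Balaban1983RegularityDecay, (1.8) p.573, (3.5) p.587] -/
theorem kForm_posDef_of_kLam_posDef [Fintype X] [Fintype Y] [Fintype Z] [DecidableEq X] [DecidableEq Y]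
    [DecidableEq Z] (H : Matrix X X ℝ) {ak : ℝ} (Qk : Matrix Y X ℝ) {a ℓ w : ℝ} {Q : Matrix Z Y ℝ}
    {Λ : Finset Y} {Λ' : Finset Z} (hak : 0 < ak) (ha : 0 < a) (hℓ : 0 < ℓ) (hw : 0 < w) (hQ : RowOrtho w Q)
    (hB : BlockCompatible Q Λ Λ') (hKΛ : (kLam H ak Qk a ℓ w Q Λ Λ').PosDef) : (kForm H ak Qk).PosDef := by
  have e : kForm H ak Qk = kLam H ak Qk a ℓ w Q Λ Λ' + (kForm H ak Qk - kLam H ak Qk a ℓ w Q Λ Λ') := by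
    abel
  rw [e]
  exact hKΛ.add_posSemidef (posSemidef_kForm_sub_kLam H Qk hak ha hℓ hw hQ hB)

/-- A positive definite real form of shape (3.5) has a SYMMETRIC `H` (`K̂_Λ` Hermitian, the two averaging terms
symmetric) — the hypothesis `H.IsSymm` of `B4GaussRep36.Rep36` is redundant given `(kLam …).PosDef`.
[cite: Balaban1983RegularityDecay, (3.5) p.587] -/
theorem isSymm_of_kLam_posDef [Fintype Y] [Fintype Z] [DecidableEq Y] [DecidableEq Z] {H : Matrix X X ℝ}
    {ak : ℝ} {Qk : Matrix Y X ℝ} {a ℓ w : ℝ} {Q : Matrix Z Y ℝ} {Λ : Finset Y} {Λ' : Finset Z}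
    (hKΛ : (kLam H ak Qk a ℓ w Q Λ Λ').PosDef) : H.IsSymm := by
  have hH := hKΛ.isHermitian
  rw [Matrix.IsHermitian, Matrix.conjTranspose_eq_transpose_of_trivial, kLam] at hH
  simp only [Matrix.transpose_add, Matrix.transpose_smul, Matrix.transpose_mul, Matrix.transpose_transpose,
    diagInd_transpose, Matrix.mul_assoc] at hH
  unfold Matrix.IsSymm
  exact add_right_cancel (add_right_cancel hH)

/-- **(3.6)** with the economical hypothesis list: for `a_k, a, L^{−2}, w = L^d > 0`, `RowOrtho`, `BlockCompatible`
and the positivity (1.8) of the two-scale form (3.5) ALONE, `C^{(k)}_Λ(Ω,A) = TG_k(Ω,Λ,A)Tᵀ − (a_{k+1}/a_k²)L^{−2}P|_Λ +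
a_k⁻¹·1_Λ` (`B4GaussRep36Proof.rep36` BY NAME, its hypotheses `H.IsSymm` and `(kForm …).PosDef` derived here).
[cite: Balaban1983RegularityDecay, (3.6) p.588] -/
theorem rep36_of_kLam_posDef [Fintype X] [Fintype Y] [Fintype Z] [DecidableEq X] [DecidableEq Y]
    [DecidableEq Z] (H : Matrix X X ℝ) {ak : ℝ} (Qk : Matrix Y X ℝ) {a ℓ w : ℝ} {Q : Matrix Z Y ℝ}
    {Λ : Finset Y} {Λ' : Finset Z} (hak : 0 < ak) (ha : 0 < a) (hℓ : 0 < ℓ) (hw : 0 < w) (hQ : RowOrtho w Q)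
    (hB : BlockCompatible Q Λ Λ') (hKΛ : (kLam H ak Qk a ℓ w Q Λ Λ').PosDef) :
    cLam H ak Qk a ℓ w Q Λ = rep36Rhs H ak Qk a ℓ w Q Λ Λ' :=
  B4GaussRep36Proof.rep36 H ak Qk a ℓ w Q Λ Λ' (isSymm_of_kLam_posDef hKΛ) hak ha hℓ hw hQ hB
    (kForm_posDef_of_kLam_posDef H Qk hak ha hℓ hw hQ hB hKΛ) hKΛ

/-! ## §3. The functions (3.7)/(3.8) (`tOp`): supports in the `L`-blocks, Gram matrix, norms -/

/-- The operator of (3.6)/(3.8) as `T = [(1 − θ·P_{Λ'})Q_k]|_{rows Λ}` with `θ = a_{k+1}L^{−2}/a_k` and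
`P_{Λ'} = wQᵀ1_{Λ'}Q` (the `L`-blocks inside `Λ`). [cite: Balaban1983RegularityDecay, (3.6)–(3.8) p.588] -/
theorem tOp_eq [Fintype Y] [Fintype Z] [DecidableEq Y] [DecidableEq Z] (ak : ℝ) (Qk : Matrix Y X ℝ) (a ℓ w : ℝ)
    (Q : Matrix Z Y ℝ) (Λ : Finset Y) (Λ' : Finset Z) :
    tOp ak Qk a ℓ w Q Λ Λ' =
      (((1 : Matrix Y Y ℝ) - (aNext a ak ℓ * ℓ / ak) • (w • (Qᵀ * diagInd Λ' * Q))) * Qk).submatrix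
        Subtype.val id := by
  rw [tOp, qNext]
  simp only [Matrix.sub_mul, Matrix.one_mul, Matrix.smul_mul, smul_smul, Matrix.mul_assoc]
  rw [show aNext a ak ℓ * ℓ / ak * w = aNext a ak ℓ / ak * w * ℓ from by ring]

/-- SUPPORT: the function `−(a_{k+1}/a_k)L^{−2}q_{k+1}(y) + q_k(y)` of (3.8) (row `y ∈ Λ` of `tOp`) is supported in the
`L`-block `B^{k+1}(z(y))` = the sites `x` with `Blk(blk x) = Blk y` — *"their supports are in B^k(y), B^{k+1}(z(y))
respectively"* (p. 588), for block-averaging `Q_k` (blocks `blk`) and `Q` (blocks `Blk`). [cite: Balaban1983RegularityDecay, (3.7)–(3.8) p.588] -/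
theorem tOp_apply_ne_zero [Fintype Y] [Fintype Z] [Fintype ι] [DecidableEq Z] [DecidableEq ι]
    {blk : X → Y} {Blk : Y → Z} {qk : Y → X → ℝ} {q : Z → Y → ℝ}
    (hqk : ∀ y x, blk x ≠ y → qk y x = 0) (hq : ∀ z y, Blk y ≠ z → q z y = 0)
    (Tk : Y → X → Matrix ι ι ℝ) (T : Z → Y → Matrix ι ι ℝ) (ak a ℓ w : ℝ) (Λ : Finset (Y × ι))
    (Λ' : Finset (Z × ι)) {p : Λ} {r : X × ι}
    (h : tOp ak (avgOp qk Tk) a ℓ w (avgOp q T) Λ Λ' p r ≠ 0) : Blk (blk r.1) = Blk p.1.1 := by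
  simp only [tOp, Matrix.submatrix_apply, id_eq, Matrix.sub_apply, Matrix.smul_apply, smul_eq_mul] at h
  by_cases h1 : avgOp qk Tk p.1 r ≠ 0
  · rw [avgOp_apply_ne_zero hqk Tk h1]
  · rw [not_not] at h1
    rw [h1, zero_sub, neg_ne_zero, mul_ne_zero_iff] at h
    have h2 := h.2
    rw [Matrix.mul_apply] at h2
    obtain ⟨s, _, hs⟩ := Finset.exists_ne_zero_of_sum_ne_zero h2
    rw [mul_ne_zero_iff] at hs
    obtain ⟨hs1, hs2⟩ := hs
    -- `(Qᵀ 1_{Λ'})(p, s) ≠ 0` forces `Blk p = s`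
    have hps : Blk p.1.1 = s.1 := by
      simp only [diagInd, Matrix.mul_diagonal, Matrix.transpose_apply] at hs1
      exact avgOp_apply_ne_zero hq T (mul_ne_zero_iff.mp hs1).1
    -- `(Q Q_k)(s, r) ≠ 0` forces `Blk (blk r) = s`
    rw [qNext, Matrix.mul_apply] at hs2
    obtain ⟨p', _, hp'⟩ := Finset.exists_ne_zero_of_sum_ne_zero hs2
    rw [mul_ne_zero_iff] at hp'
    rw [hps, ← avgOp_apply_ne_zero hq T hp'.1, avgOp_apply_ne_zero hqk Tk hp'.2]

/-- `P_{Λ'} = wQᵀ1_{Λ'}Q` is idempotent under `RowOrtho`. [folklore] -/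
private theorem projL_mul_self [Fintype Y] [Fintype Z] [DecidableEq Z] {w : ℝ} {Q : Matrix Z Y ℝ}
    (hQ : RowOrtho w Q) (hw : w ≠ 0) (Λ' : Finset Z) :
    (w • (Qᵀ * diagInd Λ' * Q)) * (w • (Qᵀ * diagInd Λ' * Q)) = w • (Qᵀ * diagInd Λ' * Q) := by
  have hQ' : Q * Qᵀ = w⁻¹ • (1 : Matrix Z Z ℝ) := hQ
  have hDD : diagInd Λ' * diagInd Λ' = diagInd Λ' := diagInd_mul_self Λ'
  calc (w • (Qᵀ * diagInd Λ' * Q)) * (w • (Qᵀ * diagInd Λ' * Q))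
      = (w * w) • (Qᵀ * diagInd Λ' * (Q * Qᵀ) * (diagInd Λ' * Q)) := by
        simp only [Matrix.smul_mul, Matrix.mul_smul, smul_smul, Matrix.mul_assoc]
    _ = (w * w * w⁻¹) • (Qᵀ * (diagInd Λ' * diagInd Λ') * Q) := by
        rw [hQ']
        simp only [Matrix.smul_mul, Matrix.mul_smul, smul_smul, Matrix.mul_one, Matrix.mul_assoc]
    _ = w • (Qᵀ * diagInd Λ' * Q) := by rw [hDD, mul_inv_cancel_right₀ hw, Matrix.mul_assoc]

/-- The averaging coefficient `θ = a_{k+1}L^{−2}/a_k = aL^{−2}/(aL^{−2} + a_k)` lies in `[0,1)`, so `0 ≤ θ(2 − θ)`.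
[cite: Balaban1983RegularityDecay, (3.4) p.587] -/
theorem theta_mul_two_sub_nonneg {a ak ℓ : ℝ} (hak : 0 < ak) (ha : 0 ≤ a) (hℓ : 0 ≤ ℓ) :
    0 ≤ aNext a ak ℓ * ℓ / ak * (2 - aNext a ak ℓ * ℓ / ak) := by
  have hden : 0 < a * ℓ + ak := by positivity
  have hθ : aNext a ak ℓ * ℓ / ak = a * ℓ / (a * ℓ + ak) := by
    rw [aNext, div_eq_div_iff (hak.ne') hden.ne']
    field_simp
  rw [hθ]
  have h1 : 0 ≤ a * ℓ / (a * ℓ + ak) := by positivity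
  have h2 : a * ℓ / (a * ℓ + ak) ≤ 1 := by rw [div_le_one hden]; linarith
  nlinarith

/-- THE GRAM MATRIX of the functions (3.8): `TTᵀ = c_k·(1 − θ(2−θ)P_{Λ'})|_Λ` for `Q_kQ_kᵀ = c_k·1` (orthogonal rows of
the unit-block averaging), `RowOrtho w Q`, `θ = a_{k+1}L^{−2}/a_k`. [cite: Balaban1983RegularityDecay, (3.7)–(3.8) p.588] -/
theorem tOp_mul_transpose [Fintype X] [Fintype Y] [Fintype Z] [DecidableEq Y] [DecidableEq Z] {ak : ℝ}
    {Qk : Matrix Y X ℝ} {a ℓ w ck : ℝ} {Q : Matrix Z Y ℝ} (hQ : RowOrtho w Q) (hw : w ≠ 0)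
    (hQk : Qk * Qkᵀ = ck • (1 : Matrix Y Y ℝ)) (Λ : Finset Y) (Λ' : Finset Z) :
    tOp ak Qk a ℓ w Q Λ Λ' * (tOp ak Qk a ℓ w Q Λ Λ')ᵀ =
      ck • ((1 : Matrix Y Y ℝ) - ((aNext a ak ℓ * ℓ / ak) * (2 - aNext a ak ℓ * ℓ / ak)) •
        (w • (Qᵀ * diagInd Λ' * Q))).submatrix Subtype.val Subtype.val := by
  set θ : ℝ := aNext a ak ℓ * ℓ / ak with hθ
  set P' : Matrix Y Y ℝ := w • (Qᵀ * diagInd Λ' * Q) with hP'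
  have hP't : P'ᵀ = P' := by
    rw [hP', Matrix.transpose_smul, Matrix.transpose_mul, Matrix.transpose_mul, Matrix.transpose_transpose,
      diagInd_transpose, Matrix.mul_assoc]
  have hPP : P' * P' = P' := projL_mul_self hQ hw Λ'
  have hMt : ((1 : Matrix Y Y ℝ) - θ • P')ᵀ = 1 - θ • P' := by
    rw [Matrix.transpose_sub, Matrix.transpose_one, Matrix.transpose_smul, hP't]
  have hN : ((1 : Matrix Y Y ℝ) - θ • P') * Qk * (((1 : Matrix Y Y ℝ) - θ • P') * Qk)ᵀ =
      ck • ((1 : Matrix Y Y ℝ) - (θ * (2 - θ)) • P') := by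
    rw [Matrix.transpose_mul, hMt, Matrix.mul_assoc, ← Matrix.mul_assoc Qk, hQk, Matrix.smul_mul, Matrix.one_mul,
      Matrix.mul_smul]
    congr 1
    simp only [Matrix.sub_mul, Matrix.mul_sub, Matrix.one_mul, Matrix.mul_one, Matrix.smul_mul, Matrix.mul_smul,
      smul_sub, smul_smul, hPP]
    rw [show θ * (2 - θ) = θ + θ - θ * θ from by ring, sub_smul, add_smul]
    abel
  rw [tOp_eq, ← hθ, ← hP', Matrix.transpose_submatrix, submatrix_id_mul, hN]
  rfl

/-- THE GRAM FORM IS BOUNDED BY `c_k`: `⟨u, TTᵀu⟩ ≤ c_k|u|²` — the plain form of *"The L²-norms of the functions q_k(y),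
q_{k+1}(y) are equal to 1, L^{−d/2}"* as the operator bound `‖T‖² ≤ c_k` used for (1.15)/(1.16).
[cite: Balaban1983RegularityDecay, (3.7)–(3.8) p.588] -/
theorem tOp_gram_form_le [Fintype X] [Fintype Y] [Fintype Z] [DecidableEq Y] [DecidableEq Z] {ak : ℝ}
    {Qk : Matrix Y X ℝ} {a ℓ w ck : ℝ} {Q : Matrix Z Y ℝ} (hak : 0 < ak) (ha : 0 ≤ a) (hℓ : 0 ≤ ℓ) (hw : 0 < w)
    (hQ : RowOrtho w Q) (hQk : Qk * Qkᵀ = ck • (1 : Matrix Y Y ℝ)) (hck : 0 ≤ ck) (Λ : Finset Y) (Λ' : Finset Z)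
    (u : Λ → ℝ) :
    u ⬝ᵥ ((tOp ak Qk a ℓ w Q Λ Λ' * (tOp ak Qk a ℓ w Q Λ Λ')ᵀ) *ᵥ u) ≤ ck * (u ⬝ᵥ u) := by
  rw [tOp_mul_transpose hQ hw.ne' hQk Λ Λ', Matrix.smul_mulVec, dotProduct_smul, smul_eq_mul]
  refine mul_le_mul_of_nonneg_left ?_ hck
  have hDD : diagInd Λ' * diagInd Λ' = diagInd Λ' := diagInd_mul_self Λ'
  set B : Matrix Z Λ ℝ := (diagInd Λ' * Q).submatrix id Subtype.val with hBdef
  have hB : (Qᵀ * diagInd Λ' * Q).submatrix (Subtype.val : Λ → Y) Subtype.val = Bᵀ * B := by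
    rw [hBdef, Matrix.transpose_submatrix, submatrix_id_mul, Matrix.transpose_mul, diagInd_transpose]
    congr 1
    symm
    rw [Matrix.mul_assoc, ← Matrix.mul_assoc (diagInd Λ') (diagInd Λ') Q, hDD, ← Matrix.mul_assoc]
  have hBB : 0 ≤ (B *ᵥ u) ⬝ᵥ (B *ᵥ u) := by simpa using dotProduct_star_self_nonneg (B *ᵥ u)
  rw [sm_sub, sm_smul, sm_smul, Matrix.submatrix_one _ Subtype.val_injective, hB, Matrix.sub_mulVec,
    Matrix.one_mulVec, dotProduct_sub, Matrix.smul_mulVec, Matrix.smul_mulVec, dotProduct_smul, dotProduct_smul,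
    ← Matrix.mulVec_mulVec, Matrix.dotProduct_mulVec u Bᵀ, Matrix.vecMul_transpose, smul_eq_mul, smul_eq_mul]
  nlinarith [mul_nonneg (theta_mul_two_sub_nonneg hak ha hℓ) (mul_nonneg hw.le hBB)]

/-- EACH FUNCTION OF (3.8) HAS PLAIN SQUARE NORM `≤ c_k`: `t_y·t_y = c_k(1 − θ(2−θ)P_{Λ'}(y,y)) ≤ c_k` — with `c_k = η^d`
and the `η^{−d}`-weighted norm of the DICTIONARY this is `‖−(a_{k+1}/a_k)L^{−2}q_{k+1}(y) + q_k(y)‖₂ ≤ 1`, from *"The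
L²-norms of the functions q_k(y), q_{k+1}(y) are equal to 1, L^{−d/2}"* (p. 588). [cite: Balaban1983RegularityDecay, (3.7)–(3.8) p.588] -/
theorem tOp_row_sq_le [Fintype X] [Fintype Y] [Fintype Z] [DecidableEq Y] [DecidableEq Z] {ak : ℝ}
    {Qk : Matrix Y X ℝ} {a ℓ w ck : ℝ} {Q : Matrix Z Y ℝ} (hak : 0 < ak) (ha : 0 ≤ a) (hℓ : 0 ≤ ℓ) (hw : 0 < w)
    (hQ : RowOrtho w Q) (hQk : Qk * Qkᵀ = ck • (1 : Matrix Y Y ℝ)) (hck : 0 ≤ ck) (Λ : Finset Y) (Λ' : Finset Z)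
    (y : Λ) :
    (fun x => tOp ak Qk a ℓ w Q Λ Λ' y x) ⬝ᵥ (fun x => tOp ak Qk a ℓ w Q Λ Λ' y x) ≤ ck := by
  have h := congrFun (congrFun (tOp_mul_transpose (ak := ak) (a := a) (ℓ := ℓ) hQ hw.ne' hQk Λ Λ') y) y
  rw [Matrix.mul_apply] at h
  simp only [Matrix.transpose_apply, Matrix.smul_apply, Matrix.submatrix_apply, Matrix.sub_apply,
    Matrix.one_apply_eq, smul_eq_mul] at h
  have e : (fun x => tOp ak Qk a ℓ w Q Λ Λ' y x) ⬝ᵥ (fun x => tOp ak Qk a ℓ w Q Λ Λ' y x) =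
      ∑ x, tOp ak Qk a ℓ w Q Λ Λ' y x * tOp ak Qk a ℓ w Q Λ Λ' y x := rfl
  rw [e, h]
  have hP : 0 ≤ (Qᵀ * diagInd Λ' * Q) (y : Y) (y : Y) := by
    rw [Matrix.mul_apply]
    refine Finset.sum_nonneg fun z _ => ?_
    simp only [diagInd, Matrix.mul_diagonal, Matrix.transpose_apply]
    split_ifs <;> nlinarith [mul_self_nonneg (Q z y)]
  nlinarith [mul_nonneg hck (mul_nonneg (theta_mul_two_sub_nonneg hak ha hℓ) (mul_nonneg hw.le hP))]

/-! ## §4. (3.6) for the block-averaging operators themselves -/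

/-- **(3.6) FOR THE LATTICE BLOCK AVERAGING** (the structure hypotheses of `Rep36` discharged): let `Q = avgOp q T` be
the `L`-averaging (3.2) — weights `n⁻¹ = L^{−d}` on the blocks `B(z) = Blk⁻¹(z)` of `n` unit-lattice points each,
orthogonal transporters `U(A(Γ_{z,y}))` — let `Λ` be the union of the blocks labelled by `S'` («Λ being a sum of big
blocks») and `Λ' = S' ×` colours.  Then for ANY `H`, `Q_k`, `a_k, a, L^{−2} > 0` such that the form (3.5) of `G_k(Ω,Λ,A)`
is positive definite ((1.8)), `C^{(k)}_Λ(Ω,A) = TG_k(Ω,Λ,A)Tᵀ − (a_{k+1}/a_k²)L^{−2}P(A)|_Λ + a_k⁻¹1_Λ` (3.6).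
[cite: Balaban1983RegularityDecay, (3.6) p.588] -/
theorem rep36_avgOp [Fintype X] [Fintype Y] [Fintype Z] [Fintype ι] [DecidableEq X] [DecidableEq Y]
    [DecidableEq Z] [DecidableEq ι] {Blk : Y → Z} {q : Z → Y → ℝ} (T : Z → Y → Matrix ι ι ℝ) {n : ℕ}
    (hn : 0 < n) (hq : ∀ z y, Blk y ≠ z → q z y = 0) (hqc : ∀ y, q (Blk y) y = (n : ℝ)⁻¹)
    (hcard : ∀ z, (univ.filter fun y => Blk y = z).card = n) (hT : ∀ y, T (Blk y) y * (T (Blk y) y)ᵀ = 1)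
    {S' : Finset Z} {Λ : Finset (Y × ι)} {Λ' : Finset (Z × ι)} (hΛ : ∀ p, p ∈ Λ ↔ Blk p.1 ∈ S')
    (hΛ' : ∀ r, r ∈ Λ' ↔ r.1 ∈ S') (H : Matrix X X ℝ) {ak a ℓ : ℝ} (Qk : Matrix (Y × ι) X ℝ) (hak : 0 < ak)
    (ha : 0 < a) (hℓ : 0 < ℓ) (hKΛ : (kLam H ak Qk a ℓ (n : ℝ) (avgOp q T) Λ Λ').PosDef) :
    cLam H ak Qk a ℓ (n : ℝ) (avgOp q T) Λ = rep36Rhs H ak Qk a ℓ (n : ℝ) (avgOp q T) Λ Λ' :=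
  rep36_of_kLam_posDef H Qk hak ha hℓ (by exact_mod_cast hn) (rowOrtho_avgOp Blk q T n hq hqc hcard hT)
    (blockCompatible_avgOp hq T hΛ hΛ') hKΛ

end Literature.MathematicalPhysics.QuantumFieldTheory.Balaban1983to89.B4Sect3BlockAveraging
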